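import Literature.AlgebraicGeometry.AbelianSchemes.AbelianSchemeConstSubgroupQuotientKernel
import Literature.AlgebraicGeometry.AbelianSchemes.FibreHomPointsOfFibrePoints
import Literature.AlgebraicGeometry.AbelianSchemes.AbelianSchemeOverRestrictPt
import Mathlib.SetTheory.Cardinal.Finite
import HarnessLib

/-!
# The kernel of `ψ_s : A_s(Ω) → (A/K)_s(Ω)` has exactly `|K|` points ([MumfordAV1970] §7 Thm. 4)

Topic `AlgebraicGeometry/AbelianSchemes`; namespace `Literature.AlgebraicGeometry.AbelianSchemes.AbelianSchemeOver`.
THEOREMS ONLY (no definition, no named fact, no instance, no notation, no `sorry`; net Literature debt 0).  Cell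
hodgecm-mathlib (D-0151), HECKE-LINK line, socket (B): the per-geometric-point KERNEL COUNT feeding the `hcount` binder of ★
`HeckeQuotientTripleHasType.Polarization.hasType_polarizationDesc_of_count` (B-plan1 (g15) 00:34:18Z (2): «(DET) → `hKr` →
B-p03 `hcount`»).  For the quotient `ψ : A → A/K` of an abelian scheme by a finite constant subgroup `K ⊆ A(S)` acting FREELY
on geometric points (★ `AbelianSchemeConstSubgroupQuotient`), at every geometric point `s : Spec Ω → S`:
* `restrict_injective_of_free` — `σ ↦ σ(s̄)` is injective on `K` (freeness);
* `ker_fibreHom_quotientMk_eq_range_restrictPt` — the kernel of `ψ_s` on `Ω`-points of the fibre is EXACTLY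
  `{σ(s̄) : σ ∈ K}` (★ `comp_quotientMk_eq_one_iff` read through ★ `map_fibreHom_eq_one_iff_of_fibrePoints`);
* **`natCard_ker_fibreHom_quotientMk`** — hence `|ker ψ_s| = |K|`, and `finite_ker_fibreHom_quotientMk`.
Applied twice (to `(A, K)` and to the dual side `(Â, K′)`) this turns `hcount` into the bookkeeping `|K| = |K′| = n^g`
((DET) B-p15 + B-p08's `hcard`).  HC_CM is proved only modulo the 7 printed citations until rung 0 closes; this file
discharges none of them.

## References
* [MumfordAV1970] D. Mumford, *Abelian Varieties* (1970), §7 Thm. 4 (p. 72) (quotient by a finite group acting freely: the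
  fibres of `ψ` are the orbits).
* [MumfordFogartyKirwan1994] D. Mumford, J. Fogarty, F. Kirwan, *Geometric Invariant Theory*, 3rd ed. (1994), Ch. 7 §2
  Def. 7.1 (p. 129) (the points `σᵢ(s)` of the fibre).
-/

set_option autoImplicit false

noncomputable section

universe u

open CategoryTheory CategoryTheory.Limits AlgebraicGeometry MonoidalCategory CartesianMonoidalCategory
open scoped MonObj

namespace Literature.AlgebraicGeometry.AbelianSchemes

namespace AbelianSchemeOver

open Literature.AlgebraicGeometry.RelativeSpec Literature.AlgebraicGeometry.Motives

variable {S : Scheme.{u}} (A : AbelianSchemeOver S)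
  {Y : Scheme.{u}} (u : S ⟶ Y) (K : Subgroup A.Sections) [Finite K] [Y.IsSeparated]
  [IsSeparated (A.X.hom ≫ u)] [S.IsSeparated]
  (hcov : ∀ x : A.left, ∃ O : (A.translationActionOver u K).StableAffineOpens, x ∈ O.1)
  [LocallyOfFiniteType (A.X.hom ≫ u)] [IsLocallyNoetherian Y]
  (hG : ∃ _ : GrpObj (A.quotientOver u K), IsMonHom (A.quotientMk u K hcov))
  (hsm : Smooth (A.quotientOver u K).hom) (hgc : GeometricallyConnected (A.quotientOver u K).hom)

omit [Finite K] [S.IsSeparated] in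
/-- **Freeness ⇒ `σ ↦ σ(s̄)` is injective on `K`**: if `σ(s̄) = τ(s̄)` for `σ, τ ∈ K` then `ρ := σ τ⁻¹ ∈ K` has
`ρ(s̄) = 1`, so the translation `t_ρ` fixes the `Ω`-point `1(s̄)` (`x ≫ t_ρ = ρ(s̄) · x`), forcing `ρ = 1`.
[cite: MumfordAV1970, §7 Thm. 4 (p. 72)] [cite: MumfordFogartyKirwan1994, Ch. 7 §2 Definition 7.1 (p. 129)] -/
theorem restrict_injective_of_free
    (hfree : ∀ (Ω : Type u) [Field Ω] [IsAlgClosed Ω] (x : Spec (.of Ω) ⟶ A.left) (σ : K), σ ≠ 1 →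
      x ≫ (A.translation (σ : A.Sections)).left ≠ x)
    {Ω : Type u} [Field Ω] [IsAlgClosed Ω] (s : Spec (.of Ω) ⟶ S) :
    Function.Injective fun σ : K => A.restrict s (σ : A.Sections) := by
  intro σ τ h
  simp only at h
  by_contra hne
  have hρ : σ * τ⁻¹ ≠ (1 : K) := fun h1 => hne (mul_inv_eq_one.1 h1)
  -- `ρ(s̄) = 1`
  have hrestr : A.restrict s ((σ * τ⁻¹ : K) : A.Sections) = 1 := by
    have hmul : A.restrict s ((σ * τ⁻¹ : K) : A.Sections) * A.restrict s (τ : A.Sections) =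
        A.restrict s (σ : A.Sections) := by
      rw [← A.restrict_mul s, Subgroup.coe_mul, Subgroup.coe_inv, inv_mul_cancel_right]
    rw [h] at hmul
    exact mul_eq_right.1 hmul
  -- the translation by `ρ` fixes the point `1(s̄)`
  refine hfree Ω (1 : A.FibrePoints s).left (σ * τ⁻¹) hρ ?_
  have h1 : (1 : A.FibrePoints s) ≫ A.translation ((σ * τ⁻¹ : K) : A.Sections) = 1 := by
    rw [A.comp_translation, mul_one]
    exact hrestr
  change ((1 : A.FibrePoints s) ≫ A.translation ((σ * τ⁻¹ : K) : A.Sections)).left = (1 : A.FibrePoints s).left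
  rw [h1]

/-- **The kernel of `ψ_s` on `Ω`-points of the fibre is `{σ(s̄) : σ ∈ K}`** (★ `comp_quotientMk_eq_one_iff` read in the
`AlgPoints` currency through ★ `map_fibreHom_eq_one_iff_of_fibrePoints`). [cite: MumfordAV1970, §7 Thm. 4 (p. 72)] -/
theorem ker_fibreHom_quotientMk_eq_range_restrictPt [IsAffine Y]
    (hfree : ∀ (Ω : Type u) [Field Ω] [IsAlgClosed Ω] (x : Spec (.of Ω) ⟶ A.left) (σ : K), σ ≠ 1 →
      x ≫ (A.translation (σ : A.Sections)).left ≠ x)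
    {Ω : Type u} [Field Ω] [IsAlgClosed Ω] (s : Spec (.of Ω) ⟶ S) :
    letI : GrpObj (A.quotientOver u K) := (A.quotientBy u K hcov hG hsm hgc).grpObj
    haveI : @IsMonHom _ _ _ A.X (A.quotientBy u K hcov hG hsm hgc).X _ _ (A.quotientMk u K hcov) :=
      A.isMonHom_quotientMk u K hcov hG hsm hgc
    ((IsMonHom.monoidHom (fibreHom (show A.X ⟶ (A.quotientBy u K hcov hG hsm hgc).X from A.quotientMk u K hcov) s).hom.hom.hom
        (specOver Ω Ω)).ker : Set ((A.fibre s).toAbelianVariety.Points Ω)) =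
      Set.range fun σ : K => A.restrictPt s (σ : A.Sections) := by
  letI : GrpObj (A.quotientOver u K) := (A.quotientBy u K hcov hG hsm hgc).grpObj
  haveI hψ : @IsMonHom _ _ _ A.X (A.quotientBy u K hcov hG hsm hgc).X _ _ (A.quotientMk u K hcov) :=
    A.isMonHom_quotientMk u K hcov hG hsm hgc
  ext P
  rw [SetLike.mem_coe, MonoidHom.mem_ker]
  change AlgPoints.map (fibreHom (show A.X ⟶ (A.quotientBy u K hcov hG hsm hgc).X from A.quotientMk u K hcov) s).hom.hom.hom
      P = 1 ↔ _
  rw [map_fibreHom_eq_one_iff_of_fibrePoints s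
    (show A.X ⟶ (A.quotientBy u K hcov hG hsm hgc).X from A.quotientMk u K hcov) (K : Set A.Sections)
    (fun x => (A.comp_quotientMk_eq_one_iff u K hcov hG hsm hgc hfree s x).trans
      ⟨fun ⟨σ, hσ⟩ => ⟨σ, σ.2, hσ⟩, fun ⟨σ, hσK, hσ⟩ => ⟨⟨σ, hσK⟩, hσ⟩⟩) P]
  constructor
  · rintro ⟨σ, hσK, rfl⟩
    exact ⟨⟨σ, hσK⟩, rfl⟩
  · rintro ⟨σ, rfl⟩
    exact ⟨σ, σ.2, rfl⟩

/-- **`|ker ψ_s| = |K|` at every geometric point** (`Ω` algebraically closed): the kernel on `Ω`-points is `{σ(s̄) : σ ∈ K}`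
and `σ ↦ σ(s̄)` is injective on `K`. [cite: MumfordAV1970, §7 Thm. 4 (p. 72)] [cite: MumfordFogartyKirwan1994, Ch. 7 §2 Definition 7.1 (p. 129)] -/
theorem natCard_ker_fibreHom_quotientMk [IsAffine Y]
    (hfree : ∀ (Ω : Type u) [Field Ω] [IsAlgClosed Ω] (x : Spec (.of Ω) ⟶ A.left) (σ : K), σ ≠ 1 →
      x ≫ (A.translation (σ : A.Sections)).left ≠ x)
    {Ω : Type u} [Field Ω] [IsAlgClosed Ω] (s : Spec (.of Ω) ⟶ S) :
    letI : GrpObj (A.quotientOver u K) := (A.quotientBy u K hcov hG hsm hgc).grpObj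
    haveI : @IsMonHom _ _ _ A.X (A.quotientBy u K hcov hG hsm hgc).X _ _ (A.quotientMk u K hcov) :=
      A.isMonHom_quotientMk u K hcov hG hsm hgc
    Nat.card (IsMonHom.monoidHom
        (fibreHom (show A.X ⟶ (A.quotientBy u K hcov hG hsm hgc).X from A.quotientMk u K hcov) s).hom.hom.hom
        (specOver Ω Ω)).ker = Nat.card K := by
  letI : GrpObj (A.quotientOver u K) := (A.quotientBy u K hcov hG hsm hgc).grpObj
  haveI hψ : @IsMonHom _ _ _ A.X (A.quotientBy u K hcov hG hsm hgc).X _ _ (A.quotientMk u K hcov) :=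
    A.isMonHom_quotientMk u K hcov hG hsm hgc
  have hinj : Function.Injective fun σ : K => A.restrictPt s (σ : A.Sections) := by
    intro σ τ h
    simp only at h
    exact A.restrict_injective_of_free K hfree s ((A.restrictPt_eq_restrictPt_iff s _ _).1 h)
  have hset := A.ker_fibreHom_quotientMk_eq_range_restrictPt u K hcov hG hsm hgc hfree s
  rw [← SetLike.coe_sort_coe, hset]
  exact Nat.card_range_of_injective hinj

/-- The kernel of `ψ_s` on `Ω`-points is finite. [cite: MumfordAV1970, §7 Thm. 4 (p. 72)] -/
theorem finite_ker_fibreHom_quotientMk [IsAffine Y]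
    (hfree : ∀ (Ω : Type u) [Field Ω] [IsAlgClosed Ω] (x : Spec (.of Ω) ⟶ A.left) (σ : K), σ ≠ 1 →
      x ≫ (A.translation (σ : A.Sections)).left ≠ x)
    {Ω : Type u} [Field Ω] [IsAlgClosed Ω] (s : Spec (.of Ω) ⟶ S) :
    letI : GrpObj (A.quotientOver u K) := (A.quotientBy u K hcov hG hsm hgc).grpObj
    haveI : @IsMonHom _ _ _ A.X (A.quotientBy u K hcov hG hsm hgc).X _ _ (A.quotientMk u K hcov) :=
      A.isMonHom_quotientMk u K hcov hG hsm hgc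
    Finite (IsMonHom.monoidHom
        (fibreHom (show A.X ⟶ (A.quotientBy u K hcov hG hsm hgc).X from A.quotientMk u K hcov) s).hom.hom.hom
        (specOver Ω Ω)).ker := by
  letI : GrpObj (A.quotientOver u K) := (A.quotientBy u K hcov hG hsm hgc).grpObj
  haveI hψ : @IsMonHom _ _ _ A.X (A.quotientBy u K hcov hG hsm hgc).X _ _ (A.quotientMk u K hcov) :=
    A.isMonHom_quotientMk u K hcov hG hsm hgc
  have hne : Nat.card (IsMonHom.monoidHom
      (fibreHom (show A.X ⟶ (A.quotientBy u K hcov hG hsm hgc).X from A.quotientMk u K hcov) s).hom.hom.hom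
      (specOver Ω Ω)).ker ≠ 0 := by
    rw [A.natCard_ker_fibreHom_quotientMk u K hcov hG hsm hgc hfree s]
    exact Nat.card_pos.ne'
  exact Nat.finite_of_card_ne_zero hne

end AbelianSchemeOver

end Literature.AlgebraicGeometry.AbelianSchemes

end
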